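import Summits.QuantumAdvantage.QuantumAdvantage.Theorems.CubicForrelationNearExactIsExactWalshTower
import Summits.QuantumAdvantage.QuantumAdvantage.Theorems.CubicForrelationNearExactIsExactAxParity
import Summits.QuantumAdvantage.QuantumAdvantage.Theorems.CubicForrelationNearExactIsExactLevelCapacity
import Summits.QuantumAdvantage.QuantumAdvantage.Theorems.CubicForrelationNearExactIsExactBentDuality
import Summits.QuantumAdvantage.QuantumAdvantage.Theorems.CubicForrelationNearExactIsExactHouCubic
import Summits.QuantumAdvantage.QuantumAdvantage.Theorems.CubicForrelationNearExactIsExactIsolationSmallN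
import Summits.QuantumAdvantage.QuantumAdvantage.Theorems.CubicForrelationNearExactIsExactRothausB

/-!
# Crux `CubicForrelation.NearExactIsExact` (stmt-QuantumAdvantage-14043), line `direct-sum-amplification`, lead c6 cycle 2 (wave 3):
  stub `stub_eightBitEndgame` — the 8-bit endgame of the balanced split

Data: `E` cubic, `D, Q` quadratic on 8 bits, slices `G[a,b'] = E ⊕ QD ⊕ aQ ⊕ b'D`, cubic partners `F a b'`.  If the two slices `G[·,¬b]`
are bent and the two slices `G[·,b]` are type O (`W = 8·odd`), then `¼ Σ_{a,b'} Φ₈(F a b', G[a,b']) ≤ 7/8`.  The first antecedent is the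
statement of the registered stub `stub_typeE8` (quadratic perturbations of 8-bit cubic bent functions have `W ≡ 0 mod 16`), which the lead
discharges at composition time.

Proof (every ingredient is a landed tree lemma).
* Type-O slices (`b' = b`): `W = 2³·u` with `u` odd everywhere, so the level-3 parity is the constant `1` (degree `≤ 0`, non-zero) and
  `stub_levelCapacity` (`m = 4`, `j = 3`, `d = 0`) gives `Σ|W| ≤ 2¹²·7/8`; `tw_forrelation_le_of_cap` turns this into `Φ ≤ 7/8` for every
  partner (`ee_typeO_le`).
* Bent slices (`b' = ¬b`): the dual has degree `≤ 4` (Rothaus, `bb_dual_isDegLeFun`) and the partner is cubic, so by the Reed–Muller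
  distance `d(RM(4,8)) = 16` (`bb_band_of_dual_degree bb_rmWeight_holds`, `d₀ = 4`) `Φ = 1 ∨ Φ ≤ 7/8` (`ee_bent_dichotomy`).
* An EXACT bent slice is impossible: `Φ(F, G[a,¬b]) = 1` makes the cubic `F` the dual (`bb_forrelation_eq_one_iff`), so `G[a,¬b]` is
  the dual of the cubic bent `F` (`bb_W_dual`) and is itself CUBIC by Hou's bound at `n = 8` (`stub_houCubic stub_axParity`,
  `⌊7/2⌋ = 3`; `ee_exact_isDegLeFun`).  But `G[a,b] = G[a,¬b] ⊕ D` pointwise, and the type-E lemma says `W_{G[a,¬b] ⊕ D} ≡ 0 (mod 16)`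
  — contradicting type O (`16k = 8(2k'+1)` is a parity contradiction).
* Hence all four slice forrelations are `≤ 7/8`, the sum is `≤ 7/2`, and `¼ Σ ≤ 7/8` (`ee_main`; the registered statement is its
  instance `G a b' w = E w ⊕ Q w D w ⊕ a Q w ⊕ b' D w`, the pointwise identity `(¬b ∧ δ) ⊕ δ = b ∧ δ` being checked on Booleans).

Sources: X.-D. Hou, *Cubic bent functions*, Discrete Math. 189 (1998) 149–161 (cubic bent duals; the landed `stub_houCubic`);
O. S. Rothaus, *On "bent" functions*, JCTA 20 (1976); C. Carlet, *Boolean Functions for Cryptography and Coding Theory*, CUP 2021,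
Thm 7 (RM minimum distance), Thm 13, §6.1; S. Aaronson, A. Ambainis, *Forrelation*, SIAM J. Comput. 47 (2018) §1.1.1.  Everything
below is proved from Mathlib and the tree; axioms are the standard three.
-/

set_option linter.dupNamespace false -- D-0017: single-problem summit ⇒ `QuantumAdvantage.QuantumAdvantage` by design

noncomputable section

namespace Summit.QuantumAdvantage.QuantumAdvantage.Theorems.CubicForrelation.NearExactIsExact

open Finset
open Literature.Computability.QuantumComplexity
open Literature.Computability.QuantumComplexity.BuzetChailloux (bxor zeroVec signOf_sq)
open Literature.Computability.QuantumComplexity.DerivativeWalsh (W)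

/-- **Type-O slices have capacity `≤ 7/8`.** If every Walsh value of `g : 𝔽₂⁸ → 𝔽₂` is `8·odd`, then `Φ(f,g) ≤ 7/8` for EVERY
`f`: the level-3 parity is the constant `1`, of degree `≤ 0` and non-zero, so `stub_levelCapacity` (`m = 4`, `j = 3`, `d = 0`) gives
`Σ|W_g| ≤ 2¹²·(1 − ½·¼)`, and capacity bounds forrelation (`tw_forrelation_le_of_cap`). -/
theorem ee_typeO_le (f g : (Fin (4 + 4) → Bool) → Bool)
    (hO : ∀ x, ∃ k : ℤ, W (fun y => signOf (g y)) x = 8 * (2 * k + 1)) :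
    forrelation f g ≤ 7 / 8 := by
  choose k hk using hO
  have hu : ∀ x, W (fun y => signOf (g y)) x = (2 : ℝ) ^ 3 * ((2 * k x + 1 : ℤ) : ℝ) := by
    intro x
    rw [hk x]
    push_cast
    ring
  have hP0 : IsDegLeFun 0 (fun x => decide (Odd (2 * k x + 1))) := by
    have : (fun x => decide (Odd (2 * k x + 1))) = fun _ : Fin (4 + 4) → Bool => true :=
      funext fun x => decide_eq_true (odd_two_mul_add_one (k x))
    rw [this]
    exact isDegLeFun_const 0 true
  have hcap := stub_levelCapacity 4 3 0 g (fun x => 2 * k x + 1) (by norm_num) hu hP0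
    ⟨fun _ => false, odd_two_mul_add_one (k fun _ => false)⟩
  have := tw_forrelation_le_of_cap f g hcap
  norm_num at this
  exact this

/-- **Bent slices: exact or `≤ 7/8`.** If `g : 𝔽₂⁸ → 𝔽₂` is bent with dual `d` (`W_g = 2⁴(−1)^d`) and `f` is cubic, then
`Φ(f,g) = 1 ∨ Φ(f,g) ≤ 7/8`: the dual has degree `≤ 4` (Rothaus, `bb_dual_isDegLeFun`), so the word `f ⊕ d` lies in `RM(4,8)`,
whose minimum distance is `16 = 2⁸/2⁴` (`bb_band_of_dual_degree bb_rmWeight_holds` with `d₀ = 4`). -/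
theorem ee_bent_dichotomy (f g d : (Fin (4 + 4) → Bool) → Bool) (hf : IsDegLeFun 3 f)
    (hd : ∀ x, W (fun y => signOf (g y)) x = (2 : ℝ) ^ 4 * signOf (d x)) :
    forrelation f g = 1 ∨ forrelation f g ≤ 7 / 8 := by
  have hdd : IsDegLeFun 4 d := bb_dual_isDegLeFun (m := 4) (by norm_num) hd
  rcases bb_band_of_dual_degree bb_rmWeight_holds 4 4 f g d (hf.mono (by norm_num)) hdd hd with h | h
  · exact Or.inl h
  · right
    norm_num at h
    exact h

/-- **An exact cubic partner makes the bent slice cubic** (Hou at `n = 8`). If `g : 𝔽₂⁸ → 𝔽₂` is bent with dual `d`, `f` is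
cubic and `Φ(f,g) = 1`, then `f = d` (`bb_forrelation_eq_one_iff`), so `g` is the dual of the cubic bent function `f`
(`bb_W_dual`) and has degree `≤ ⌊(4+3)/2⌋ = 3` (`stub_houCubic stub_axParity`). -/
theorem ee_exact_isDegLeFun (f g d : (Fin (4 + 4) → Bool) → Bool) (hf : IsDegLeFun 3 f)
    (hd : ∀ x, W (fun y => signOf (g y)) x = (2 : ℝ) ^ 4 * signOf (d x)) (h1 : forrelation f g = 1) :
    IsDegLeFun 3 g := by
  have hfd : f = d := (bb_forrelation_eq_one_iff f g d hd).1 h1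
  subst hfd
  have hdual : ∀ x, W (fun y => signOf (f y)) x = (2 : ℝ) ^ 4 * signOf (g x) := bb_W_dual hd
  exact stub_houCubic stub_axParity 4 f g hf hdual

/-- **The 8-bit endgame, abstract form.** Given the type-E lemma `hTE` (the statement of `stub_typeE8`): for a quadratic `D`, cubic
partners `F a b'` and slices `G a b'` on 8 bits with `G[a,b] = G[a,¬b] ⊕ D` pointwise, if the slices `G[·,¬b]` are bent and the
slices `G[·,b]` are type O (`W = 8·odd`), then `¼ Σ_{a,b'} Φ(F a b', G a b') ≤ 7/8`.  Type-O slices: `≤ 7/8` (`ee_typeO_le`); bent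
slices: `= 1 ∨ ≤ 7/8` (`ee_bent_dichotomy`), and `= 1` is impossible — the slice would be cubic (`ee_exact_isDegLeFun`), so by `hTE`
the Walsh values of `G[a,¬b] ⊕ D = G[a,b]` would be `≡ 0 (mod 16)`, not `8·odd`. -/
theorem ee_main
    (hTE : ∀ (A B : (Fin (4 + 4) → Bool) → Bool), IsDegLeFun 3 A → IsDegLeFun 2 B →
      (∀ x, W (fun y => signOf (A y)) x ^ 2 = (2 : ℝ) ^ (4 + 4)) →
      ∀ x, ∃ k : ℤ, W (fun y => signOf (A y ^^ B y)) x = 16 * (k : ℝ))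
    (D : (Fin (4 + 4) → Bool) → Bool) (F G : Bool → Bool → (Fin (4 + 4) → Bool) → Bool) (b : Bool)
    (hD : IsDegLeFun 2 D) (hF : ∀ a b', IsDegLeFun 3 (F a b'))
    (hB : ∀ a x, W (fun w => signOf (G a (!b) w)) x ^ 2 = (2 : ℝ) ^ (4 + 4))
    (hO : ∀ a x, ∃ k : ℤ, W (fun w => signOf (G a b w)) x = 8 * (2 * k + 1))
    (hGD : ∀ a w, (G a (!b) w ^^ D w) = G a b w) :
    ¬ (7 / 8 < (1 / 4 : ℝ) * ∑ a : Bool, ∑ b' : Bool, forrelation (F a b') (G a b')) := by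
  intro hΦ
  -- the two type-O slices
  have hOle : ∀ a, forrelation (F a b) (G a b) ≤ 7 / 8 := fun a => ee_typeO_le (F a b) (G a b) (hO a)
  -- the two bent slices: an exact one is impossible
  have hBle : ∀ a, forrelation (F a (!b)) (G a (!b)) ≤ 7 / 8 := by
    intro a
    obtain ⟨d, hd⟩ := bb_exists_dual (m := 4) (hB a)
    rcases ee_bent_dichotomy (F a (!b)) (G a (!b)) d (hF a (!b)) hd with h1 | h
    · exfalso
      have hcubic : IsDegLeFun 3 (G a (!b)) := ee_exact_isDegLeFun (F a (!b)) (G a (!b)) d (hF a (!b)) hd h1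
      obtain ⟨k, hk⟩ := hTE (G a (!b)) D hcubic hD (hB a) (fun _ => false)
      obtain ⟨k', hk'⟩ := hO a (fun _ => false)
      simp_rw [hGD] at hk
      have h : (16 : ℝ) * (k : ℝ) = 8 * (2 * (k' : ℝ) + 1) := hk.symm.trans hk'
      have hz : (16 * k : ℤ) = 8 * (2 * k' + 1) := by exact_mod_cast h
      omega
    · exact h
  -- all four slice forrelations are `≤ 7/8`
  have hle : ∀ a b', forrelation (F a b') (G a b') ≤ 7 / 8 := by
    intro a b'
    obtain rfl | rfl : b' = b ∨ b' = !b := by cases b' <;> cases b <;> decide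
    · exact hOle a
    · exact hBle a
  have hS : ∑ a : Bool, ∑ b' : Bool, forrelation (F a b') (G a b') ≤ 7 / 2 :=
    calc ∑ a : Bool, ∑ b' : Bool, forrelation (F a b') (G a b')
        ≤ ∑ _a : Bool, ∑ _b' : Bool, (7 / 8 : ℝ) := sum_le_sum fun a _ => sum_le_sum fun b' _ => hle a b'
      _ = 7 / 2 := by simp only [Fintype.sum_bool]; norm_num
  linarith

/-- **The 8-bit endgame of the balanced split.**  Given the type-E lemma (first antecedent = the statement of
`stub_typeE8`): for `E` cubic and `D, Q` quadratic on 8 bits with slices `G[a,b'] = E ⊕ QD ⊕ aQ ⊕ b'D` and cubic partners `F a b'`, if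
`G[·,¬b]` are bent and `G[·,b]` are type O then `¼ Σ_{a,b'} Φ₈(F a b', G[a,b']) ≤ 7/8`. [this line; uses X.-D. Hou, Discrete Math. 189
(1998) (cubic bent duals, the landed `stub_houCubic`) and the Reed–Muller distance `d(RM(4,8)) = 16`]  The instance
`G a b' w = E w ⊕ Q w D w ⊕ a Q w ⊕ b' D w` of `ee_main` (pointwise `G[a,¬b] ⊕ D = G[a,b]` since `(¬b ∧ δ) ⊕ δ = b ∧ δ`); the degree
hypotheses on `E` and `Q` are not needed (Hou's bound supplies the degree of the exact slice directly). -/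
theorem stub_eightBitEndgame :
    (∀ (A B : (Fin (4 + 4) → Bool) → Bool), IsDegLeFun 3 A → IsDegLeFun 2 B →
      (∀ x, W (fun y => signOf (A y)) x ^ 2 = (2 : ℝ) ^ (4 + 4)) →
      ∀ x, ∃ k : ℤ, W (fun y => signOf (A y ^^ B y)) x = 16 * (k : ℝ)) →
    ∀ (E D Q : (Fin (4 + 4) → Bool) → Bool) (F : Bool → Bool → (Fin (4 + 4) → Bool) → Bool) (b : Bool),
      IsDegLeFun 3 E → IsDegLeFun 2 D → IsDegLeFun 2 Q → (∀ a b', IsDegLeFun 3 (F a b')) →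
      (∀ a x, W (fun w => signOf (E w ^^ (Q w && D w) ^^ (a && Q w) ^^ (!b && D w))) x ^ 2 = (2 : ℝ) ^ (4 + 4)) →
      (∀ a x, ∃ k : ℤ, W (fun w => signOf (E w ^^ (Q w && D w) ^^ (a && Q w) ^^ (b && D w))) x = 8 * (2 * k + 1)) →
      ¬ (7 / 8 < (1 / 4 : ℝ) * ∑ a : Bool, ∑ b' : Bool,
        forrelation (F a b') (fun w => E w ^^ (Q w && D w) ^^ (a && Q w) ^^ (b' && D w))) := by
  intro hTE E D Q F b _hE hD _hQ hF hB hO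
  exact ee_main hTE D F (fun a b' w => E w ^^ (Q w && D w) ^^ (a && Q w) ^^ (b' && D w)) b hD hF hB hO
    (fun a w => by
      generalize E w = e
      generalize Q w = q
      generalize D w = δ
      revert e q δ
      cases a <;> cases b <;> decide)

end Summit.QuantumAdvantage.QuantumAdvantage.Theorems.CubicForrelation.NearExactIsExact

end
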